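import Summits.QuantumFields.BalabanUV.Beta.GAN24.Symbol166PseudoInverse

/-!
# GAN24 / Symbol166PseudoInverseLink — part 2 of `Symbol166PseudoInverse`: the (1.66) matrix symbol `sym166` IS the `Σ_{μ≠ν}` four-term
# bond-basis combination of b05's entry symbols `Gsym` (the integrand whose lattice kernels gan24-p2's `deltaZ` sums)

Cell `pub-balaban`, β sub-cell, BINDER ROW **G-an2-4 ∕ (CONV-C)** (NOT IN PRINT), prover part **P3 = WOODBURY-FIBRE reduction** (unit
`b2b-balaban-gan24-p3`, gen 2).  HONEST FRAMING (verbatim): discharging `BetaPertH` makes Bałaban's UV stability UNCONDITIONAL — a real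
constructive-QFT result; it is NOT the continuum limit and NOT the Clay problem.  HONEST DEPENDENCY: continuum YM on T⁴ ⇐ BetaPertH ∧ nine spine
estimates (0/9 proved); BetaPertH ⇐ (D1) ∧ (D4) ∧ CAP+tail; G-an2-4 gates asym, D1 and NE2/3/4.  ABSOLUTE RULE honoured: `[folklore]` finite algebra
over b05-g9's `B5Symbol166Strip.Gsym` / `Gsym_ofReal` BY NAME; nothing printed is a hypothesis; no `Prop` minted.

CONTENT: `dirC`, `summandC` (the complex twin of gan24-p2's `DirichletExhaustionDeltaZ.dirI`/`summand`), indicator bookkeeping, and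
**`sym166_eq_sum_Gsym`**: on the punctured Brillouin zone, `Σ_μ Σ_ν [μ ≠ ν]·summandC (Gsym n μ ν · · (ι s)) μ ν α β = sym166 n s α β`.  So gan24-p2's
`deltaZ L k (x,α) (y,β) = Σ_{μ≠ν} summand (kerRe …) …` is, entry by entry, the lattice kernel of the matrix symbol that part 1 identified as the
Moore–Penrose inverse `(P⊥ diag(φ) P⊥)⁺` (the remaining step to SAY so in position space is linearity of `B4ContourShift.latticeKernel` over the
finite sum — bookkeeping for the junction seats).  NOT BetaPertH, NOT continuum, NOT Clay.
-/

noncomputable section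

open Finset Matrix Complex
open scoped BigOperators ComplexConjugate
open Literature.MathematicalPhysics.QuantumFieldTheory.Balaban1983to89
open B4Strip (S1r Delta1r ofRealVec)
open B5Prop11Fiber (d1Sym norm_d1Sym_sq Delta0_eq)
open B5Prop11Leaves (Delta1r_pos)
open B5Bounds167Lattice (phi162 w166 Delta0_phi162_lower)
open B5Symbol166Strip (Gsym Gsym_ofReal)

namespace Summit.QuantumFields.BalabanUV.Beta.GAN24.Symbol166PseudoInverse

variable {d : ℕ}

/-! ## §4 The link to the entry symbols summed by gan24-p2's `deltaZ` -/

section Link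

variable (n : ℕ) [NeZero n] (s : Fin d → ℝ)

/-- The direction indicator `ι_κ(α) = [κ = α]` as a complex number. [folklore] -/
def dirC (κ α : Fin d) : ℂ := if κ = α then 1 else 0

/-- The four-term bond-basis combination of an entry-symbol family `G a b` at directions `(α, β)` (the complex twin of gan24-p2's
`DirichletExhaustionDeltaZ.summand`). [folklore] -/
def summandC (G : Fin d → Fin d → ℂ) (μ ν α β : Fin d) : ℂ :=
  dirC ν α * dirC ν β * G μ μ - dirC ν α * dirC μ β * G μ ν - dirC μ α * dirC ν β * G ν μ + dirC μ α * dirC μ β * G ν ν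

/-- The four-term combination of the real-momentum entry formula vanishes on the diagonal `μ = ν` (so `Σ_{μ≠ν} = Σ_{μ,ν}`). [folklore] -/
theorem summandC_formula_diag (w : Fin d → Fin d → ℂ) (e : Fin d → ℂ) (μ α β : Fin d) :
    summandC (fun a b => 1 / 2 * w μ μ * (conj (e a) * e b)) μ μ α β = 0 := by
  unfold summandC; ring

/-- Indicator bookkeeping: `Σ_ν ι_ν(α)ι_ν(β)·f ν = [α = β]·f α`. [folklore] -/
theorem sum_dirC_dirC_mul (α β : Fin d) (f : Fin d → ℂ) :
    ∑ ν, dirC ν α * dirC ν β * f ν = if α = β then f α else 0 := by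
  have e : ∀ ν, dirC ν α * dirC ν β * f ν = if ν = α then (if α = β then f α else 0) else 0 := by
    intro ν
    unfold dirC
    by_cases h1 : ν = α
    · subst h1
      by_cases h2 : ν = β
      · subst h2; simp
      · simp [h2]
    · simp [h1]
  simp_rw [e]
  rw [Finset.sum_ite_eq' Finset.univ α, if_pos (Finset.mem_univ α)]

/-- Indicator bookkeeping: `Σ_ν ι_ν(α)·g ν = g α`. [folklore] -/
theorem sum_dirC_mul (α : Fin d) (g : Fin d → ℂ) : ∑ ν, dirC ν α * g ν = g α := by
  unfold dirC
  simp only [ite_mul, one_mul, zero_mul, Finset.sum_ite_eq', Finset.mem_univ, if_true]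

/-- Indicator bookkeeping: `Σ_μ Σ_ν ι_ν(α)ι_μ(β)·f μ ν = f β α`. [folklore] -/
theorem sum_sum_dirC_mul (α β : Fin d) (f : Fin d → Fin d → ℂ) :
    ∑ μ, ∑ ν, dirC ν α * dirC μ β * f μ ν = f β α := by
  have inner : ∀ μ, ∑ ν, dirC ν α * dirC μ β * f μ ν = dirC μ β * f μ α := by
    intro μ
    have e : ∀ ν, dirC ν α * dirC μ β * f μ ν = dirC ν α * (dirC μ β * f μ ν) := fun ν => by ring
    simp_rw [e]
    exact sum_dirC_mul α (fun ν => dirC μ β * f μ ν)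
  simp_rw [inner]
  exact sum_dirC_mul β (fun μ => f μ α)

/-- **`sym166` IS THE `Σ_{μ≠ν}` FOUR-TERM COMBINATION OF b05's ENTRY SYMBOLS** `Gsym n μ ν a b (ι p) = ½ w₁₆₆ conj ∂_a ∂_b` — the per-momentum
integrand whose lattice kernel gan24-p2's `deltaZ` is (its `summand` over `kerRe = Re latticeKernel Gsym`): for `(α, β)` the bond directions,
`Σ_μ Σ_ν [μ ≠ ν]·summandC (Gsym n μ ν · · (ι s)) μ ν α β = sym166 n s α β` on the punctured Brillouin zone. [folklore] -/
theorem sym166_eq_sum_Gsym (hs : ∀ κ, |s κ| ≤ Real.pi) (ν₀ : Fin d) (hν₀ : s ν₀ ≠ 0) (α β : Fin d) :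
    (∑ μ, ∑ ν, if μ = ν then 0 else summandC (fun a b => Gsym n μ ν a b (ofRealVec s)) μ ν α β) = sym166 n s α β := by
  have hG : ∀ μ ν, μ ≠ ν → ∀ a b, Gsym n μ ν a b (ofRealVec s) = 1 / 2 * (w166 n μ ν s : ℂ) * (conj (d1Sym s a) * d1Sym s b) :=
    fun μ ν h a b => Gsym_ofReal n h a b s hs ν₀ hν₀
  -- (1) the real-momentum formula, (2) the diagonal terms vanish anyway
  have e1 : (∑ μ, ∑ ν, if μ = ν then 0 else summandC (fun a b => Gsym n μ ν a b (ofRealVec s)) μ ν α β) =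
      ∑ μ, ∑ ν, summandC (fun a b => 1 / 2 * (w166 n μ ν s : ℂ) * (conj (d1Sym s a) * d1Sym s b)) μ ν α β := by
    refine Finset.sum_congr rfl fun μ _ => Finset.sum_congr rfl fun ν _ => ?_
    split_ifs with h
    · subst h
      exact (summandC_formula_diag (fun μ ν => (w166 n μ ν s : ℂ)) (fun a => d1Sym s a) μ α β).symm
    · simp only [summandC, hG μ ν h]
  rw [e1]
  -- (3) split the four terms and do the indicator sums
  have eT : ∀ μ ν, summandC (fun a b => 1 / 2 * (w166 n μ ν s : ℂ) * (conj (d1Sym s a) * d1Sym s b)) μ ν α β =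
      dirC ν α * dirC ν β * (1 / 2 * (w166 n μ ν s : ℂ) * (conj (d1Sym s μ) * d1Sym s μ)) -
      dirC ν α * dirC μ β * (1 / 2 * (w166 n μ ν s : ℂ) * (conj (d1Sym s μ) * d1Sym s ν)) -
      dirC μ α * dirC ν β * (1 / 2 * (w166 n μ ν s : ℂ) * (conj (d1Sym s ν) * d1Sym s μ)) +
      dirC μ α * dirC μ β * (1 / 2 * (w166 n μ ν s : ℂ) * (conj (d1Sym s ν) * d1Sym s ν)) := fun μ ν => rfl
  simp_rw [eT, Finset.sum_add_distrib, Finset.sum_sub_distrib]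
  -- T1 and T2: inner sum over ν
  have hT1 : ∑ μ, ∑ ν, dirC ν α * dirC ν β * (1 / 2 * (w166 n μ ν s : ℂ) * (conj (d1Sym s μ) * d1Sym s μ)) =
      if α = β then ∑ μ, 1 / 2 * (w166 n μ α s : ℂ) * (conj (d1Sym s μ) * d1Sym s μ) else 0 := by
    simp_rw [sum_dirC_dirC_mul]
    split_ifs <;> simp
  have hT2 : ∑ μ, ∑ ν, dirC ν α * dirC μ β * (1 / 2 * (w166 n μ ν s : ℂ) * (conj (d1Sym s μ) * d1Sym s ν)) =
      1 / 2 * (w166 n β α s : ℂ) * (conj (d1Sym s β) * d1Sym s α) :=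
    sum_sum_dirC_mul α β (fun μ ν => 1 / 2 * (w166 n μ ν s : ℂ) * (conj (d1Sym s μ) * d1Sym s ν))
  -- T3 and T4: swap the sums first
  have hT3 : ∑ μ, ∑ ν, dirC μ α * dirC ν β * (1 / 2 * (w166 n μ ν s : ℂ) * (conj (d1Sym s ν) * d1Sym s μ)) =
      1 / 2 * (w166 n α β s : ℂ) * (conj (d1Sym s β) * d1Sym s α) := by
    rw [Finset.sum_comm]
    exact sum_sum_dirC_mul α β (fun ν μ => 1 / 2 * (w166 n μ ν s : ℂ) * (conj (d1Sym s ν) * d1Sym s μ))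
  have hT4 : ∑ μ, ∑ ν, dirC μ α * dirC μ β * (1 / 2 * (w166 n μ ν s : ℂ) * (conj (d1Sym s ν) * d1Sym s ν)) =
      if α = β then ∑ ν, 1 / 2 * (w166 n α ν s : ℂ) * (conj (d1Sym s ν) * d1Sym s ν) else 0 := by
    rw [Finset.sum_comm]
    simp_rw [sum_dirC_dirC_mul]
    split_ifs <;> simp
  rw [hT1, hT2, hT3, hT4]
  -- (4) compare with the definition of `sym166`
  have hS : ∀ γ, ∑ μ, 1 / 2 * (w166 n μ γ s : ℂ) * (conj (d1Sym s μ) * d1Sym s μ) =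
      1 / 2 * (((∑ κ, w166 n κ γ s * ‖d1Sym s κ‖ ^ 2 : ℝ)) : ℂ) := by
    intro γ
    push_cast
    rw [Finset.mul_sum]
    refine Finset.sum_congr rfl fun κ _ => ?_
    rw [conj_mul_d1Sym]; push_cast; ring
  have hS' : ∀ γ, ∑ ν, 1 / 2 * (w166 n γ ν s : ℂ) * (conj (d1Sym s ν) * d1Sym s ν) =
      1 / 2 * (((∑ κ, w166 n κ γ s * ‖d1Sym s κ‖ ^ 2 : ℝ)) : ℂ) := by
    intro γ
    rw [← hS γ]
    exact Finset.sum_congr rfl fun κ _ => by rw [w166_symm n s γ κ]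
  simp only [sym166, Matrix.of_apply]
  by_cases hab : α = β
  · subst hab
    simp only [if_true]
    rw [hS α, hS' α]
    ring
  · simp only [hab, if_false]
    rw [w166_symm n s β α]
    ring

end Link


/-! ## §5 Uniqueness: how a junction seat concludes `X = sym166` (v1.1, append-only) -/

section Unique

variable (n : ℕ) [NeZero n] (s : Fin d → ℝ)

/-- **UNIQUENESS OF THE PSEUDO-INVERSE, in the form the junction needs**: any matrix `X` with `X·S = P⊥` (it inverts the gauge-projected
alias-sum matrix on the physical subspace) and `X·P⊥ = X` (it annihilates coarse pure-gauge data) IS the printed (1.66) symbol.  So the mm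
dictionary `MultDict`/`hdict` per fibre reduces to these two identities for `X := (s_m²/c)·ŵΦ^{(N)}(p)`. [folklore] -/
theorem eq_sym166_of_mul_projPhi (hs : ∀ κ, |s κ| ≤ Real.pi) (ν₀ : Fin d) (hν₀ : s ν₀ ≠ 0) {X : Matrix (Fin d) (Fin d) ℂ}
    (hXS : X * projPhi n s = perp s) (hXP : X * perp s = X) : X = sym166 n s := by
  calc X = X * perp s := hXP.symm
    _ = X * (projPhi n s * sym166 n s) := by rw [projPhi_mul_sym166 n s hs ν₀ hν₀]
    _ = (X * projPhi n s) * sym166 n s := by rw [Matrix.mul_assoc]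
    _ = perp s * sym166 n s := by rw [hXS]
    _ = sym166 n s := perp_mul_sym166 n s hs ν₀ hν₀

/-- The same with the hypotheses on the LEFT (`S·X = P⊥`, `P⊥·X = X`), for a column convention. [folklore] -/
theorem eq_sym166_of_projPhi_mul (hs : ∀ κ, |s κ| ≤ Real.pi) (ν₀ : Fin d) (hν₀ : s ν₀ ≠ 0) {X : Matrix (Fin d) (Fin d) ℂ}
    (hSX : projPhi n s * X = perp s) (hPX : perp s * X = X) : X = sym166 n s := by
  calc X = perp s * X := hPX.symm
    _ = (sym166 n s * projPhi n s) * X := by rw [sym166_mul_projPhi n s hs ν₀ hν₀]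
    _ = sym166 n s * (projPhi n s * X) := by rw [Matrix.mul_assoc]
    _ = sym166 n s * perp s := by rw [hSX]
    _ = sym166 n s := sym166_mul_perp n s hs ν₀ hν₀

/-- `X·P⊥ = X` follows from the gauge-null property `X·∂ = 0` alone. [folklore] -/
theorem mul_perp_eq_self_of_mulVec_dvec {X : Matrix (Fin d) (Fin d) ℂ} (hX : X *ᵥ dvec s = 0) : X * perp s = X := by
  have hE : X * gaugeProj s = 0 := by
    ext μ ν
    have h' : X *ᵥ d1Sym s = 0 := hX
    rw [gaugeProj, mul_outer_apply, h', Pi.zero_apply, zero_mul, Matrix.zero_apply]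
  rw [perp, Matrix.mul_sub, Matrix.mul_one, Matrix.mul_smul, hE, smul_zero, sub_zero]

end Unique

end Summit.QuantumFields.BalabanUV.Beta.GAN24.Symbol166PseudoInverse

end
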